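import Summits.SmoothPoincare4.SmoothPoincare4.Theses.ZeroSurgeryExotic
import Summits.SmoothPoincare4.SmoothPoincare4.Theorems.DottedCircleRasmussenDcrEngineGlue
import Summits.SmoothPoincare4.SmoothPoincare4.Theorems.DottedCircleRasmussenDcrGfgmw
import Summits.SmoothPoincare4.SmoothPoincare4.Theorems.DottedCircleRasmussenDcrGapStubDepthZeroImport

/-!
# Crux `DcrGap` (stmt-SmoothPoincare4-16128), line `Sketch` — the sorry-free reduction

Helper `helper_reduction` of the line (registered on the crux item): the COMPOSITION of the line's
skeleton (`Cruxes/DcrGap/Lines/Sketch.lean`, `DcrGap_of`) made durable and `sorry`-free as a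
conditional theorem over the two stubs that remain open —

  `(ZseHsliceNotSlice ∨ DcrRasmussenWitness) → MMSW.sMinus_nonpos_of_isModelSliceDisc → DcrGap`.

The ONE-HANDLE SLICE GAP follows from the SUPPLY (`stub_supply`, the apex: a depth-0 witness — an
`S³`-knot slice in a homotopy 4-ball but not in `B⁴`, item stmt-SmoothPoincare4-0520 — OR a Rasmussen
certificate through the dotted circles, item stmt-SmoothPoincare4-16151) and MMSW Lemma 8.19 in the
model (`stub_mmsw819`, the Literature named fact `MMSW.sMinus_nonpos_of_isModelSliceDisc`, used only on
the engine branch): the depth-0 branch is the landed `stub_depthZeroImport` (p130420, unconditional);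
the engine branch is the route's landed glue `DcrEngineGlue_proof : DcrRasmussenWitness → DcrGfgmw →
DcrGap` (p: item stmt-SmoothPoincare4-17020) fed with the landed conditional GFGMW window
`DcrGfgmw_of_mmsw819` (item stmt-SmoothPoincare4-16153's file).  Pure logic over landed theorems; no
definitions, no named facts introduced, no `sorry`.  With it the skeleton reads
`DcrGap_of := helper_reduction stub_supply stub_mmsw819`.

References: Freedman–Gompf–Morrison–Walker, Quantum Topol. 1 (2010), §1
[FreedmanGompfMorrisonWalker2010]; Manolescu–Marengon–Sarkar–Willis, Duke Math. J. 172 (2023),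
Lemma 8.19 and §9.3 [ManolescuMarengonSarkarWillis2023].
-/

noncomputable section

set_option linter.dupNamespace false

open scoped Manifold ContDiff Topology
open Function Set
open Literature.Topology.FourManifolds

namespace Summit.SmoothPoincare4.SmoothPoincare4.Theorems.DcrGap.Sketch

/-- **The engine door, conditionally on MMSW Lemma 8.19**: a Rasmussen certificate through the
dotted circles (`DcrRasmussenWitness`: `k ≥ 1`, a null-homologous model knot `K₀ ⊂ ∂D_k` sliced in the
`D_k`-complement of some homotopy 4-sphere with `s₋(K₀) > 0 ∨ s₊(K₀) < 0`) is a one-handle slice gap,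
GIVEN `MMSW.sMinus_nonpos_of_isModelSliceDisc` (Lemma 8.19 for a knot bounding a disc in
`♮ᵏ(B² × S²)`): the route's glue `DcrEngineGlue_proof` with the conditional GFGMW window
`DcrGfgmw_of_mmsw819` (Palais standardisation + Lemma 8.19 + its mirror).
[cite: ManolescuMarengonSarkarWillis2023, Lemma 8.19] [cite: FreedmanGompfMorrisonWalker2010, §1] -/
theorem dcrGap_of_dcrRasmussenWitness_of_mmsw819
    (hW : Summit.SmoothPoincare4.SmoothPoincare4.Theses.DottedCircleRasmussen.DcrRasmussenWitness)
    (h819 : Literature.Topology.FourManifolds.MMSW.sMinus_nonpos_of_isModelSliceDisc) :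
    Summit.SmoothPoincare4.SmoothPoincare4.Theses.DottedCircleRasmussen.DcrGap :=
  Summit.SmoothPoincare4.SmoothPoincare4.Theorems.DcrEngineGlue_proof hW
    (Summit.SmoothPoincare4.SmoothPoincare4.Theorems.DcrGfgmw_of_mmsw819 h819)

/-- **Helper `helper_reduction` (line `Sketch`): the crux from its two open stubs.** The one-handle
slice gap `DcrGap` follows from the supply `ZseHsliceNotSlice ∨ DcrRasmussenWitness` (the line's apex
`stub_supply`) and MMSW Lemma 8.19 in the model (`stub_mmsw819`, needed on the engine branch only):
a depth-0 witness goes through the landed `k = 0` import `stub_depthZeroImport` (re-embed the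
`S³`-knot on the ellipsoid `∂D_0`; Palais' ball-complement theorem), a Rasmussen certificate through
the engine door `dcrGap_of_dcrRasmussenWitness_of_mmsw819`. This is the skeleton's composition
`DcrGap_of`, sorry-free. [cite: FreedmanGompfMorrisonWalker2010, §1]
[cite: ManolescuMarengonSarkarWillis2023, Lemma 8.19 and §9.3] -/
theorem helper_reduction : (Summit.SmoothPoincare4.SmoothPoincare4.Theses.ZeroSurgeryExotic.ZseHsliceNotSlice ∨ Summit.SmoothPoincare4.SmoothPoincare4.Theses.DottedCircleRasmussen.DcrRasmussenWitness) → Literature.Topology.FourManifolds.MMSW.sMinus_nonpos_of_isModelSliceDisc → Summit.SmoothPoincare4.SmoothPoincare4.Theses.DottedCircleRasmussen.DcrGap :=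
  fun hs h819 => hs.elim stub_depthZeroImport fun hW => dcrGap_of_dcrRasmussenWitness_of_mmsw819 hW h819

end Summit.SmoothPoincare4.SmoothPoincare4.Theorems.DcrGap.Sketch

end
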